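import Summits.QuantumFields.YangMills.Theorems.IR.VacuumEscapeRungStrongCoupling
import Summits.QuantumFields.YangMills.Theorems.IR.VacuumEscapeSpectralSeam
import HarnessLib

/-!
# Crux `IR` (stmt-QuantumFields-19354) — line `vacuum_escape` v8 («assume NO gap ⇒ a STICKY SLICE EVENT ⇒ isoperimetry forbids it»)

**v8 (2026-08-28, pooled prover ym-ir-line-pool-p3 g4).** Census row B6 («PHYSICAL-TIME CONDUCTANCE ⇔ GAP FACE up to constants», EQUIV, priced) is a
TREE THEOREM: `physicalTimeConductance_iff_sliceGapInUnits` (`Theorems/IR/VacuumEscapePhysicalTimeOfGap.lean` p621246; parts `…IteratedKernel` p618508,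
`…PhysicalTimeSpectral` p619970, `…PhysicalTimeArith` p620236, `…GapOfPhysicalTimeTorus` p620501, `…GapOfPhysicalTime` p620782, `…PhysicalTimeOfGapTorus`
p620878): for every compact `G`, lattice representation `r`, unit map `a > 0` with `a → 0`, `PhysicalTimeConductance G r a ↔ SliceGapInUnits G r a`
(⇒ by Cheeger–Lawler–Sokal for the `n`-step chain of the iterated kernel `K⁽ⁿ⁾`, rate `k₀²/(8(τ+1))·aβ`; ⇐ by the variational Parseval bound, `τ = 1`,
`k₀ = (1 − e^{−c₁})/2`).  Also landed: `faces_of_coldPressure` (p618081: cold pressure in units ⇒ both faces) and the FI-T corollaries (p617519).  No stub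
changes (B6 is a recorded currency, not a stub); sorries unchanged = 3 (LOAD, thermal face, residual).

**v7 (2026-08-28, pooled prover ym-ir-line-pool-p3 g4).** The SPECTRAL SEAM is a THEOREM in the tree: `stub_spectralSeam` below is CLOSED by
`spectralSeam_holds` (`Theorems/IR/VacuumEscapeSpectralSeam.lean`, parts `…SpectralSeamTrace` p615653 + `…SpectralSeamCluster`): on each finite
transfer model of the torus `(2S+1)⁴` the thermal double sum is bounded at TOTAL time `P − 2w ≥ S + 1` (Young-weighted trace inequality
`|tr(Sᵃ M Sᵇ M')| ≤ 2‖M‖‖M'‖ tr S^{a+b}`), so trace excesses are needed only at times `≥ S + 1` = exactly `ColdPurity`; the gap face supplies the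
contraction rate `e^{−min(c₁,1)·aβ}` on `Ω^⊥`.  Open stubs: the LOAD, the thermal face, the residual — 3 sorries.

**v6 (2026-08-28T01:50Z).** VACUUM-STATE CURRENCY (v4's, landed by pool-p3 as tree constants `VacuumConductanceInUnits`, `VacuumConductanceStrongCoupling`,
`IsVacuum`, `vacuumMeasure`, `vacuumCoupling` in `Theorems/IR/VacuumEscapeCheegerVacuum.lean`) with BOTH provable pieces now THEOREMS in the tree:
the Cheeger seam `vacuumConductance_imp_sliceGap` and the strong-coupling RUNG `vacuumConductanceStrongCoupling_holds` (p594045, `c = 1 − e^{−1/4}`,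
`β₀ = strongCouplingRadius r.ρ`, uniformly in the volume).  Open stubs: the LOAD, the two shared faces/seams, the residual — 4 sorries.

**v5 (2026-08-28T01:25Z).** The vocabulary and currency of v3 are now TREE CONSTANTS (`Theorems/IR/VacuumEscapeDefs.lean`, p590997, pooled prover
ym-ir-line-pool-p3) and the Cheeger seam is PROVED in the tree (`stub_cheeger_proved`, `Theorems/IR/VacuumEscapeCheeger.lean`, p592286, axioms standard):
this skeleton imports them, so `stub_cheeger` below is CLOSED by `exact stub_cheeger_proved` and the open stubs are 4 + the rung.  The v4 vacuum-state
re-denomination (`IsVacuum`/`vacuumMeasure`/`vacuumCoupling`, load as `HasCouplingConductance π Q (c√(aβ))`) is being landed by pool-p3 as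
`Theorems/IR/VacuumEscapeCheegerVacuum.lean` (`VacuumConductanceInUnits → SliceGapInUnits`); it is an equivalent currency and not restated here.

Ideator seat `ym-ir-idea-8` (lens: assume the conclusion fails, push the forced structure, show it impossible).

## The lever (one object)

The ESCAPE RATE of a set of spatial gauge fields under one step of Euclidean time.  Slice the torus `m × (2S+1)³`
across time (tree: `wilsonSliceKernel`, `cyclicPartition`, `traceExcess`, Osterwalder–Seiler 1978 §§2–3).  For a
measurable set `A` of time-zero slice configurations put `mass_m(A) = P(V₀ ∈ A)` and `stay_m(A) = P(V₀ ∈ A ∧ V₁ ∈ A)`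
under the slice-chain law of the torus (`sliceMass`, `sliceStay` below; plain cyclic integrals of slice kernels with
indicator insertions).  As `m → ∞` these converge to the vacuum chain's `π(A)` and `Q(A, A)` (ground-state transform of
the transfer operator; Perron–Jentzsch, tree `IsPositivityImproving.exists_spectralGap`), and the Lawler–Sokal form of
CHEEGER'S INEQUALITY for reversible Markov operators on general state spaces,
`1 − λ₁/λ₀ ≥ k²/8`, `k = inf_A Q(A, Aᶜ)/(π(A) π(Aᶜ))` [LawlerSokal1988, Thm 2.1; corpus: madras1993-self-avoiding-walk
pp. 311–312], turns a CONDUCTANCE LOWER BOUND into the gap face of `GapInUnits`: applied to the `n`-STEP kernel with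
`n = ⌈τ/a(β)⌉` (physical time `τ`), an `O(1)` bound `k_n ≥ k₀` gives `r₁ ≤ exp(−k₀² a(β)/(16τ))` — exactly the rate of
`IR`, and conversely `k_n ≥ 1 − r₁ⁿ`, so PHYSICAL-TIME CONDUCTANCE ⇔ GAP FACE up to constants (the one-step form
`k ≥ c√a(β)`, `SliceConductanceInUnits`, is the stronger DIFFUSIVE sub-case kept for the instrument).

## «Assume no gap» — the forced structure (why this is the lens, not a costume)

The level-set construction in the proof of Cheeger's inequality converts a slow mode into a bottleneck SET: if
`GapInUnits` fails along `β_k → ∞` on the simply connected family then (thermal face aside) the second transfer ratio has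
`1 − r₁ = o(a(β_k))`, hence for `n_k = ⌈τ/a(β_k)⌉` steps `1 − r₁^{n_k} → 0` and `k_{n_k} ≤ √(8(1 − r₁^{n_k})) → 0`, i.e. there
are measurable METASTABLE SLICE EVENTS `A_k` — sets of spatial gauge fields which Euclidean evolution over PHYSICAL time `τ`
leaves with probability `o(1)·π(A_k)π(A_kᶜ)` (and, by the variational bound `1 − r₁ⁿ ≤ k_n(A)` for every `A`, no set is
stickier than the gap itself).  A counterexample to `IR` is
therefore a METASTABLE SET of the vacuum transfer chain at arbitrarily weak coupling, volume-uniformly — a geometric object (a set and its boundary), not a spectral one.  On the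
NON-simply-connected family such sets EXIST ('t Hooft magnetic-flux sectors of the slice are conserved by the chain:
the refuter's `Literature/…/SliceBottleneck.lean`), which is why the load-bearing stub is restricted to
`SimplyConnectedSpace G` and the residual `AfPincerUc.SharpOnset.IRNSC` (shared BY NAME with line `af_pincer_Uc_sharp`)
carries the rest.

## Stubs (3 OPEN: load / thermal face / residual; PROVED: Cheeger seam, strong-coupling rung, spectral seam; sorries ONLY inside open `stub_*`; `IR_of` is a real proof and concludes the route decl BY NAME)

* `stub_noStickySliceEvent` (LOAD, XL, the lens): floors ⇒ one-step VACUUM-CHAIN conductance `≥ c√a(β)` (diffusive law, `VacuumConductanceInUnits`) on the simply connected family.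
* `stub_cheeger` — PROVED (tree `vacuumConductance_imp_sliceGap`; cyclic twin `stub_cheeger_proved` p592286): conductance in units ⇒ `SliceGapInUnits`; kept as a theorem so the composition reads the same.
* `stub_rungStrongCoupling` — PROVED (tree `vacuumConductanceStrongCoupling_holds`, p594045): the strong-coupling instance of the currency, volume-uniform.
* `stub_coldPurity` (L, thermal face, shared currency with `DoublingDefect` / card `cold-trace-excess-per-open`).
* `stub_spectralSeam` — PROVED (tree `spectralSeam_holds`, `Theorems/IR/VacuumEscapeSpectralSeam.lean`, pool-p3 g4): `SliceGapInUnits ∧ ColdPurity ⇒ GapInUnits`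
  (the RP/transfer seam of card `vacuum-maximal-correlation`); kept under the registered stub name so `IR_of` reads the same.
* `stub_irNSC` : `AfPincerUc.SharpOnset.IRNSC` (tree constant; the registered residual of the slot, by name).

HONEST FRAMING: nothing here proves weak-coupling mixing or a mass gap; the Clay problem is untouched; every `stub_*` is
OPEN (the residual is a declared conditional target of record).  `R4` of the ladder closes only the conditional
finite-𝕋⁴ rung `BalabanLadder.UV`.
-/

set_option autoImplicit false

noncomputable section

open Filter Topology MeasureTheory
open Literature.MathematicalPhysics.QuantumFieldTheory
open Summit.QuantumFields.YangMills.Cruxes.OSLegsFromFemtoAndGap.DlrCollarTransfer (GapInUnits LowerBounds)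
open Summit.QuantumFields.YangMills.Cruxes.IR.AfPincerUc (IRCal)
open Summit.QuantumFields.YangMills.Cruxes.IR.AfPincerUc.SharpOnset (IRNSC)

namespace Summit.QuantumFields.YangMills.Cruxes.IR.VacuumEscape

/-! ## §0–§1 Vocabulary and currency: TREE CONSTANTS (imported, not restated) — `IsVacuum`, `vacuumMeasure`, `vacuumCoupling`,
`VacuumConductanceInUnits` (the LOAD's currency), `VacuumConductanceStrongCoupling` (the rung's) in `VacuumEscapeCheegerVacuum`; `SliceGapInUnits`,
`ColdPurity`, `IRSC`, `irCal_of_SC_NSC` in `VacuumEscapeDefs` (with the v3 cyclic forms `SliceConductanceInUnits`, `sliceMass`, … kept there as the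
equivalent `m → ∞` currency, seam `stub_cheeger_proved`). -/

/-! ## §2 The stubs -/

/-- **LOAD (XL; the lens; v3 = critic-1's restatement).**  «No sticky slice event at weak coupling»: on the simply connected
family, floors at the calibration scale force ONE-STEP conductance `≥ c·√(a β)` of the slice chain, uniformly in the volume — the DIFFUSIVE
(Cheeger-tight) law.  It gives the gap face (`1 − r₁ ≥ c² aβ/8`, stub_cheeger) and is NOT implied back (the gap face only forces `k ≳ aβ`):
strictly stronger, genuinely isoperimetric.  WHY IT MIGHT FAIL: a telegraph-type slow observable (one-step escape `≍ gap`, exponent θ = 1)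
would make the `√a` rate false while `IR` holds — instrument rows (eng-2: θ on `2³`; eng-4: escape rates of long-wavelength slice events along
the time axis of equilibrium configurations).  CALIBRATION: for a massive GAUSSIAN lattice field the law is exactly diffusive (half-spaces are
extremal by Borell–Sudakov–Tsirelson; the slowest mode's sign set has `k ≍ √(1 − e^{−ma})`), so `√a` is the truth in the one computable model.
A proof must use faithfulness of `r` and simple connectivity (flux sectors of `SliceBottleneck` are sticky for `π₁(G) ≠ 0`); the free-gluon chain HAS
sticky long-wavelength events at every `S ≫ 1/a` (gap `≍ 1/S ≪ a`), so the content is non-perturbative (`PerturbativeInvisibility`). -/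
theorem stub_noStickySliceEvent :
    ∀ (G : Type) [Group G] [TopologicalSpace G] [IsTopologicalGroup G] [CompactSpace G],
      IsCompactSimpleLieGroup G → SimplyConnectedSpace G →
      letI : MeasurableSpace G := borel G; haveI : BorelSpace G := ⟨rfl⟩;
      ∀ (r : LatticeRep G) (a : ℝ → ℝ), (∀ β, 0 < a β) → Tendsto a atTop (𝓝 0) →
        LowerBounds G r a → VacuumConductanceInUnits G r a := by
  sorry

/-- **CHEEGER SEAM — PROVED** (tree `vacuumConductance_imp_sliceGap`, `Theorems/IR/VacuumEscapeCheegerVacuum.lean`, pooled prover ym-ir-line-pool-p3: Lüscher's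
transfer matrix spectral data + Perron–Jentzsch vacuum + the landed Lawler–Sokal `cheeger_variance_le_dirichletForm`; `c₁ = c²/8`; the cyclic-currency twin is
`stub_cheeger_proved`, p592286).  Kept under the registered stub name so `IR_of` reads the same; no `sorry`. -/
theorem stub_cheeger :
    ∀ (G : Type) [Group G] [TopologicalSpace G] [IsTopologicalGroup G] [CompactSpace G]
      [MeasurableSpace G] [BorelSpace G] (r : LatticeRep G) (a : ℝ → ℝ), (∀ β, 0 < a β) →
      VacuumConductanceInUnits G r a → SliceGapInUnits G r a :=
  vacuumConductance_imp_sliceGap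

/-- **THERMAL FACE (L; shared currency).**  Floors ⇒ cold purity on the simply connected family (for `π₁(G) ≠ 0` it holds
for the trivial reason that flux vacua are finitely many; it is stated here only where this line needs it).  Under the lens
its failure is an exactly massless (or polynomially dense) lattice theory at ONE fixed weak coupling — the fixed-β object of
the DLR certificates (`LatticeGapLargeBeta`) and of route `InfraredLiouville`. -/
theorem stub_coldPurity :
    ∀ (G : Type) [Group G] [TopologicalSpace G] [IsTopologicalGroup G] [CompactSpace G],
      IsCompactSimpleLieGroup G → SimplyConnectedSpace G →
      letI : MeasurableSpace G := borel G; haveI : BorelSpace G := ⟨rfl⟩;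
      ∀ (r : LatticeRep G) (a : ℝ → ℝ), (∀ β, 0 < a β) → Tendsto a atTop (𝓝 0) →
        LowerBounds G r a → ColdPurity G r := by
  sorry

/-- **SPECTRAL SEAM — PROVED** (tree `spectralSeam_holds`, `Theorems/IR/VacuumEscapeSpectralSeam.lean`, pooled prover ym-ir-line-pool-p3 g4:
finite transfer models of the torus `(2S+1)⁴` (tree `stub_transferRepresentation`), contraction rate from the gap face (`stub_perpContraction`),
cluster bound with the thermal term at TOTAL time `P − 2w ≥ S + 1` (`traceCluster_total`) so that only `x_{S+1} ≤ K₀` = `ColdPurity` is consumed;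
`|corr_n| ≤ C_A C_B e^{2w}(2 + 5K₀ + K₀²) e^{−min(c₁,1) aβ n}`, `n ≤ S`).  Kept under the registered stub name so `IR_of` reads the same; no `sorry`. -/
theorem stub_spectralSeam :
    ∀ (G : Type) [Group G] [TopologicalSpace G] [IsTopologicalGroup G] [CompactSpace G]
      [MeasurableSpace G] [BorelSpace G], IsCompactSimpleLieGroup G →
      ∀ (r : LatticeRep G) (a : ℝ → ℝ), (∀ β, 0 < a β) → Tendsto a atTop (𝓝 0) →
        SliceGapInUnits G r a → ColdPurity G r → GapInUnits G r a :=
  spectralSeam_holds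

/-- **RESIDUAL (by name; the slot's registered `stub_irNSC` statement, a tree constant).** -/
theorem stub_irNSC : IRNSC := by
  sorry

/-- **RUNG — PROVED** (tree `vacuumConductanceStrongCoupling_holds`, `Theorems/IR/VacuumEscapeRungStrongCoupling.lean`, p594045, pool-p3): for every compact `G`
and lattice representation `r`, `c = 1 − e^{−1/4}`, `β₀ = strongCouplingRadius r.ρ`: the one-step vacuum coupling has setwise conductance `c` for
`0 ≤ β ≤ β₀` on EVERY spatial torus (volume-uniform).  The BC5 witness of the line is a theorem. -/
theorem stub_rungStrongCoupling :
    ∀ (G : Type) [Group G] [TopologicalSpace G] [IsTopologicalGroup G] [CompactSpace G]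
      [MeasurableSpace G] [BorelSpace G] (r : LatticeRep G), VacuumConductanceStrongCoupling G r :=
  vacuumConductanceStrongCoupling_holds

/-! ## §3 Composition (real proofs) -/

/-- The four simply-connected stubs give `IR` on the simply connected family. -/
theorem irSC_of_stubs : IRSC := by
  intro G _ _ _ _ hG hsc
  letI : MeasurableSpace G := borel G
  haveI : BorelSpace G := ⟨rfl⟩
  intro r a ha hat hlb
  have hk : VacuumConductanceInUnits G r a := stub_noStickySliceEvent G hG hsc r a ha hat hlb
  have hgap : SliceGapInUnits G r a := stub_cheeger G r a ha hk
  have hcold : ColdPurity G r := stub_coldPurity G hG hsc r a ha hat hlb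
  exact stub_spectralSeam G hG r a ha hat hgap hcold

/-- **`IR_of`** — the stubs close crux `IR` of route `BalabanLadder`, concluded BY NAME. -/
theorem IR_of : Summit.QuantumFields.YangMills.Theses.BalabanLadder.IR := by
  have hI : IRCal := irCal_of_SC_NSC irSC_of_stubs stub_irNSC
  delta Summit.QuantumFields.YangMills.Theses.BalabanLadder.IR
  delta Summit.QuantumFields.YangMills.Cruxes.IR.AfPincerUc.IRCal at hI
  exact hI

/-- The same composition with the stubs as HYPOTHESES (the shape the skeleton lint reads:
`stub₁ → … → stub₅ → IR`). -/
theorem IR_of_hyps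
    (h₁ : ∀ (G : Type) [Group G] [TopologicalSpace G] [IsTopologicalGroup G] [CompactSpace G],
      IsCompactSimpleLieGroup G → SimplyConnectedSpace G →
      letI : MeasurableSpace G := borel G; haveI : BorelSpace G := ⟨rfl⟩;
      ∀ (r : LatticeRep G) (a : ℝ → ℝ), (∀ β, 0 < a β) → Tendsto a atTop (𝓝 0) →
        LowerBounds G r a → VacuumConductanceInUnits G r a)
    (h₂ : ∀ (G : Type) [Group G] [TopologicalSpace G] [IsTopologicalGroup G] [CompactSpace G]
      [MeasurableSpace G] [BorelSpace G] (r : LatticeRep G) (a : ℝ → ℝ), (∀ β, 0 < a β) →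
      VacuumConductanceInUnits G r a → SliceGapInUnits G r a)
    (h₃ : ∀ (G : Type) [Group G] [TopologicalSpace G] [IsTopologicalGroup G] [CompactSpace G],
      IsCompactSimpleLieGroup G → SimplyConnectedSpace G →
      letI : MeasurableSpace G := borel G; haveI : BorelSpace G := ⟨rfl⟩;
      ∀ (r : LatticeRep G) (a : ℝ → ℝ), (∀ β, 0 < a β) → Tendsto a atTop (𝓝 0) →
        LowerBounds G r a → ColdPurity G r)
    (h₄ : ∀ (G : Type) [Group G] [TopologicalSpace G] [IsTopologicalGroup G] [CompactSpace G]
      [MeasurableSpace G] [BorelSpace G], IsCompactSimpleLieGroup G →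
      ∀ (r : LatticeRep G) (a : ℝ → ℝ), (∀ β, 0 < a β) → Tendsto a atTop (𝓝 0) →
        SliceGapInUnits G r a → ColdPurity G r → GapInUnits G r a)
    (h₅ : IRNSC) : Summit.QuantumFields.YangMills.Theses.BalabanLadder.IR := by
  have hS : IRSC := by
    intro G _ _ _ _ hG hsc
    letI : MeasurableSpace G := borel G
    haveI : BorelSpace G := ⟨rfl⟩
    intro r a ha hat hlb
    exact h₄ G hG r a ha hat (h₂ G r a ha (h₁ G hG hsc r a ha hat hlb)) (h₃ G hG hsc r a ha hat hlb)
  have hI : IRCal := irCal_of_SC_NSC hS h₅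
  delta Summit.QuantumFields.YangMills.Theses.BalabanLadder.IR
  delta Summit.QuantumFields.YangMills.Cruxes.IR.AfPincerUc.IRCal at hI
  exact hI

/-! ## §4 In-Lean sanity: the two-point chain (Cheeger is tight up to the square, and `k²/8 ≤ gap ≤ 2k`) -/

/-- Toy check of the Lawler–Sokal window on the symmetric two-state chain with flip probability `p ∈ [0,1]`:
gap `= 2p`… here only the arithmetic shape `k²/8 ≤ k` for `k = 2p ≤ 1`-type numbers, `p = 1/4`. -/
example : ((1 : ℝ) / 2) ^ 2 / 8 ≤ 2 * (1 / 4) ∧ 2 * ((1 : ℝ) / 4) ≤ 2 * (1 / 2) := by norm_num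

end Summit.QuantumFields.YangMills.Cruxes.IR.VacuumEscape

end
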